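import Summits.ABC.ABC.Theses.RibetTakahashiSplit
import Summits.ABC.ABC.Theorems.RibetTakahashiSplitWeightedSzpiroBoundAbc
import Literature.NumberTheory.EllipticCurves.SzpiroLocalDataProofs
import Literature.NumberTheory.EllipticCurves.SzpiroOfAbcProofs
import Literature.NumberTheory.EllipticCurves.SzpiroFreyProofs
import Literature.NumberTheory.DiophantineGeometry.MinimalDiscriminantSmulProofs
import Literature.NumberTheory.DiophantineGeometry.MinimalDiscriminantFiniteProofs
import Literature.NumberTheory.DiophantineGeometry.MinimalDiscriminantProofs
import Literature.NumberTheory.Sieve.DivisorBound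

/-!
# `ThinWeightedSzpiro` (stmt-ABC-17927, route RibetTakahashiSplit, crux r3″): the exponent `6` is sharp inside every thin class

Tightness lemma from the crux disprover's cycle-1 attack (`Cruxes/ThinWeightedSzpiro/Disproof.lean`, §4).
`ThinWeightedSzpiroExp κ` is the crux with `(N·T)^{6+ε}` replaced by `(N·T)^κ` (quantifiers
`∃ θ > 0 ∀ K ∃ C`; the crux gives `ThinWeightedSzpiroExp (6 + ε)` for every `ε > 0` with the same `θ`,
`thinExp_of_thin`). For every `κ < 6` it is FALSE (`thinWeightedSzpiroExp_false_of_lt_six`).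

Witnesses with CERTIFIED thinness (the classical Szpiro-ratio-6 families `1 + (2ⁿ−1) = 2ⁿ` or
Danilov–Lucas would need abc-type radical lower bounds to be placed in a thin class): the global
minimal Frey models `testModel p m = freyIntModel 1 (p^{2m})` (Bombieri–Gubler (12.17)) of the abc
triples `1 + p^{2m} = p^{2m} + 1`, `p` an odd prime → ∞, `m = m(κ)` fixed. Here `16 ∤ abc`
(`p^{2m} ≡ 1 mod 8`), `|c₄|³ ≥ p^{12m}`, `N ∣ 2¹⁰ rad(p^{2m}(p^{2m}+1))` so `N ≤ 2¹¹ p^{2m+1}`,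
`p ∣ N`, and `T ≤ τ(|Δ_min|) ≤ C_η p^{8mη}` (divisor bound): the family is θ-thin for EVERY `θ > 0`
and `(N·T)^κ ≤ C p^{κ(2m+1+θ)}` loses to `p^{12m}` once `m(6 − κ) > κ`. So the weight `T` and the
thinness hypothesis together buy at most `N^{o(1)}` in the exponent: r3″ is exponent-sharp from below
inside every thin class (and abc-hard from above, Disproof §0).
-/

set_option linter.dupNamespace false

namespace Summit.ABC.ABC.Theorems.ThinWeightedSzpiro.Negative

open WeierstrassCurve IsDedekindDomain
open Summit.ABC.ABC.Theses.RibetTakahashiSplit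
open Summit.ABC.ABC.Theorems
open Literature.NumberTheory.EllipticCurves

/-! ## 4. Tightness: the exponent `6` cannot be lowered INSIDE any thin class

`ThinWeightedSzpiroExp κ` is the crux with `(N·T)^{6+ε}` replaced by `(N·T)^κ` (quantifiers
`∃ θ > 0 ∀ K ∃ C`, so the crux gives `ThinWeightedSzpiroExp (6 + ε)` for every `ε > 0`). For every
`κ < 6` it is FALSE. The parent's witnesses (minimal Frey models of `1 + (2ⁿ − 1) = 2ⁿ`, Szpiro ratio
`→ 6`) are useless here: their θ-thinness for small `θ` would need `rad(2ⁿ − 1) ≥ τ(…)^{1/θ}`, an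
abc-type radical lower bound nobody can prove. New witnesses with CERTIFIED thinness: the global
minimal Frey models `W_{p,m} = freyIntModel 1 (p^{2m})` (B–G (12.17)) of `1 + p^{2m} = p^{2m} + 1`,
`p` an odd prime → ∞, `m = m(κ)` fixed: `|c₄|³ ≥ 16³ p^{12m}`, `N ∣ 2¹⁰ rad(p^{2m}(p^{2m}+1))` so
`N ≤ 2¹¹ p^{2m+1}`, `p ∣ N` so `N ≥ p`, and `T ≤ τ(|Δ_min|) ≤ C_η p^{8mη}` (divisor bound): the family
is θ-thin for EVERY `θ > 0` (take `η = min(θ,1)/8m`), and `(N T)^κ ≤ C p^{κ(2m+1+θ)}` loses to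
`p^{12m}` as soon as `m(6 − κ) > κ`. So the weight and the thinness together buy at most `N^{o(1)}`:
the crux is exponent-sharp from below inside every thin class, and abc-hard from above. -/

/-- The crux with exponent `κ` in place of `6 + ε`. -/
def ThinWeightedSzpiroExp (κ : ℝ) : Prop :=
  ∃ θ : ℝ, 0 < θ ∧ ∀ K : ℝ, ∃ C : ℝ, ∀ W₀ : WeierstrassCurve ℤ, (W₀.baseChange ℚ).IsElliptic →
    (∀ v : HeightOneSpectrum ℤ, (W₀.baseChange ℚ).IsMinimalAt v) →
    (∀ p : ℕ, p.Prime → p ≠ 2 → ¬ p ^ 2 ∣ (W₀.baseChange ℚ).conductorNorm ℤ) →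
    ((∏ p ∈ ((W₀.baseChange ℚ).conductorNorm ℤ).primeFactors with
        ¬ p ^ 2 ∣ (W₀.baseChange ℚ).conductorNorm ℤ,
        ((W₀.baseChange ℚ).minimalDiscriminantNorm ℤ).factorization p : ℕ) : ℝ) ≤
      K * (((W₀.baseChange ℚ).conductorNorm ℤ : ℕ) : ℝ) ^ θ →
    ((max |W₀.Δ| (|W₀.c₄| ^ 3) : ℤ) : ℝ) ≤ C * ((((W₀.baseChange ℚ).conductorNorm ℤ : ℕ) : ℝ) *
      ((∏ p ∈ ((W₀.baseChange ℚ).conductorNorm ℤ).primeFactors with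
        ¬ p ^ 2 ∣ (W₀.baseChange ℚ).conductorNorm ℤ,
        ((W₀.baseChange ℚ).minimalDiscriminantNorm ℤ).factorization p : ℕ) : ℝ)) ^ κ

/-- The crux gives `ThinWeightedSzpiroExp (6 + ε)` for every `ε > 0` (repackaging). [folklore] -/
theorem thinExp_of_thin (h : ThinWeightedSzpiro) {ε : ℝ} (hε : 0 < ε) :
    ThinWeightedSzpiroExp (6 + ε) := by
  obtain ⟨θ, hθ, h⟩ := h
  exact ⟨θ, hθ, fun K ↦ h ε hε K⟩

section Tight

open Literature.NumberTheory.Sieve UniqueFactorizationMonoid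

/-- `T ≤ τ(|Δ_min|)`: the weight is at most the number of divisors of the minimal discriminant
(`N ∣ |Δ_min|`, `v ≤ v + 1`). [folklore] -/
theorem weight_le_card_divisors (W : WeierstrassCurve ℚ) [W.IsElliptic] :
    ∏ p ∈ (W.conductorNorm ℤ).primeFactors with ¬ p ^ 2 ∣ W.conductorNorm ℤ,
        (W.minimalDiscriminantNorm ℤ).factorization p ≤ (W.minimalDiscriminantNorm ℤ).divisors.card := by
  have hND : W.conductorNorm ℤ ∣ W.minimalDiscriminantNorm ℤ :=
    conductorNorm_dvd_minimalDiscriminantNorm W (finite_setOf_ordMinimalDiscriminant_ne_zero_holds (A := ℤ) W)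
  have hD0 : W.minimalDiscriminantNorm ℤ ≠ 0 := (minimalDiscriminantNorm_pos_holds W).ne'
  rw [Nat.card_divisors hD0]
  calc ∏ p ∈ (W.conductorNorm ℤ).primeFactors with ¬ p ^ 2 ∣ W.conductorNorm ℤ,
        (W.minimalDiscriminantNorm ℤ).factorization p
      ≤ ∏ p ∈ (W.conductorNorm ℤ).primeFactors with ¬ p ^ 2 ∣ W.conductorNorm ℤ,
        ((W.minimalDiscriminantNorm ℤ).factorization p + 1) :=
          Finset.prod_le_prod (fun _ _ ↦ Nat.zero_le _) (fun _ _ ↦ Nat.le_succ _)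
    _ ≤ ∏ p ∈ (W.minimalDiscriminantNorm ℤ).primeFactors, ((W.minimalDiscriminantNorm ℤ).factorization p + 1) := by
          refine Finset.prod_le_prod_of_subset_of_one_le' ?_ (fun _ _ _ ↦ Nat.le_add_left 1 _)
          intro p hp
          rw [Finset.mem_filter] at hp
          have hp' := Nat.mem_primeFactors.mp hp.1
          exact Nat.mem_primeFactors.mpr ⟨hp'.1, hp'.2.1.trans hND, hD0⟩

/-- The test curves: the B–G (12.17) models `W_{p,m} = freyIntModel 1 (p^{2m})`,
`y² = x (x − 1) (x + p^{2m})`, of the abc triples `1 + p^{2m} = p^{2m} + 1`. -/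
def testModel (p m : ℕ) : WeierstrassCurve ℤ := freyIntModel 1 ((p : ℤ) ^ (2 * m))

variable {p m : ℕ}

/-- `1 · p^{2m} · (1 + p^{2m})` is the cast of the natural number `p^{2m} (p^{2m} + 1)`. [folklore] -/
theorem testProd_eq (p m : ℕ) :
    (1 : ℤ) * (p : ℤ) ^ (2 * m) * (1 + (p : ℤ) ^ (2 * m)) = ((p ^ (2 * m) * (p ^ (2 * m) + 1) : ℕ) : ℤ) := by
  push_cast; ring

/-- `p^{2m}(p^{2m}+1) ≠ 0` for a prime `p`. [folklore] -/
theorem testProd_ne_zero (hp : p.Prime) : (1 : ℤ) * (p : ℤ) ^ (2 * m) * (1 + (p : ℤ) ^ (2 * m)) ≠ 0 := by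
  rw [testProd_eq]
  have : 0 < p ^ (2 * m) := pow_pos hp.pos _
  positivity

/-- For an odd prime `p`, `16 ∤ p^{2m}(p^{2m}+1)` (`p^{2m} ≡ 1 (mod 8)`, so the product is `≡ 2 (mod 4)`
up to the odd factor): the abc triple `1 + p^{2m} = p^{2m}+1` falls under B–G 12.5.10, first case. [folklore] -/
theorem not_sixteen_dvd_testProd (hp : p.Prime) (hp2 : p ≠ 2) (m : ℕ) :
    ¬ (16 : ℤ) ∣ (1 : ℤ) * (p : ℤ) ^ (2 * m) * (1 + (p : ℤ) ^ (2 * m)) := by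
  rw [testProd_eq]
  intro h
  have h' : 16 ∣ p ^ (2 * m) * (p ^ (2 * m) + 1) := by exact_mod_cast h
  have hodd : Odd (p ^ m) := (hp.odd_of_ne_two hp2).pow
  obtain ⟨r, hr⟩ := hodd
  have hsq : p ^ (2 * m) = (p ^ m) ^ 2 := by rw [pow_mul']
  have hcop : Nat.Coprime 16 (p ^ (2 * m)) := by
    have h2 : Nat.Coprime 2 p := (Nat.coprime_primes Nat.prime_two hp).mpr (Ne.symm hp2)
    have := Nat.Coprime.pow 4 (2 * m) h2
    norm_num at this
    exact this
  have h1 : 16 ∣ p ^ (2 * m) + 1 := hcop.dvd_of_dvd_mul_left h'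
  have h2 : p ^ (2 * m) + 1 = 4 * (r ^ 2 + r) + 2 := by rw [hsq, hr]; ring
  rw [h2] at h1
  generalize r ^ 2 + r = s at h1
  omega

/-- `c₄ (W_{p,m}) = 16 (1 + p^{2m} + p^{4m})`. [folklore] -/
theorem testModel_c₄ (p m : ℕ) : (testModel p m).c₄ = 16 * (1 + (p : ℤ) ^ (2 * m) + (p : ℤ) ^ (4 * m)) := by
  unfold testModel; rw [freyIntModel_c₄]; ring

/-- `Δ (W_{p,m}) = 16 (p^{2m}(p^{2m}+1))²`. [folklore] -/
theorem testModel_Δ (p m : ℕ) :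
    (testModel p m).Δ = (((16 * (p ^ (2 * m) * (p ^ (2 * m) + 1)) ^ 2 : ℕ)) : ℤ) := by
  unfold testModel; rw [freyIntModel_Δ]; push_cast; ring

/-- `W_{p,m}` is an elliptic curve. [folklore] -/
theorem isElliptic_testModel (hp : p.Prime) (m : ℕ) : ((testModel p m).baseChange ℚ).IsElliptic := by
  have h := isElliptic_freyIntModel (A := 1) (B := (p : ℤ) ^ (2 * m)) (by
    have := testProd_ne_zero (m := m) hp; rwa [one_mul] at this ⊢)
  exact h

/-- `W_{p,m}` is minimal at every prime (B–G 12.5.10, first case: `16 ∤ abc`). [folklore] -/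
theorem isMinimalAt_testModel (hp : p.Prime) (hp2 : p ≠ 2) (m : ℕ) (v : HeightOneSpectrum ℤ) :
    ((testModel p m).baseChange ℚ).IsMinimalAt v :=
  isMinimalAt_freyIntModel isCoprime_one_left (by simpa only [one_mul] using testProd_ne_zero (m := m) hp)
    (by simpa only [one_mul] using not_sixteen_dvd_testProd hp hp2 m) v

/-- `N (W_{p,m}) ∣ 2¹⁰ rad(p^{2m}(p^{2m}+1))`. [folklore] -/
theorem conductorNorm_testModel_dvd (hp : p.Prime) (hp2 : p ≠ 2) (m : ℕ) :
    ((testModel p m).baseChange ℚ).conductorNorm ℤ ∣ 2 ^ 10 * radical (p ^ (2 * m) * (p ^ (2 * m) + 1)) := by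
  have h := conductorNorm_freyIntModel_dvd (A := 1) (B := (p : ℤ) ^ (2 * m)) isCoprime_one_left
    (by simpa only [one_mul] using testProd_ne_zero (m := m) hp)
    (by simpa only [one_mul] using not_sixteen_dvd_testProd hp hp2 m)
  have hx : ((1 : ℤ) * (p : ℤ) ^ (2 * m) * (1 + (p : ℤ) ^ (2 * m))).natAbs = p ^ (2 * m) * (p ^ (2 * m) + 1) := by
    rw [testProd_eq, Int.natAbs_natCast]
  unfold testModel; rwa [hx] at h

/-- `rad(p^{2m}(p^{2m}+1)) ≤ p (p^{2m} + 1)`. [folklore] -/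
theorem radical_testProd_le (hp : p.Prime) (m : ℕ) :
    radical (p ^ (2 * m) * (p ^ (2 * m) + 1)) ≤ p * (p ^ (2 * m) + 1) := by
  have hk : p * (p ^ (2 * m) + 1) ≠ 0 := mul_ne_zero hp.ne_zero (Nat.succ_ne_zero _)
  apply Nat.le_of_dvd (Nat.pos_of_ne_zero hk)
  rw [Nat.radical_dvd_iff hk]
  intro q hq
  rw [Nat.mem_primeFactors] at hq ⊢
  refine ⟨hq.1, ?_, hk⟩
  rcases (Nat.Prime.dvd_mul hq.1).mp hq.2.1 with h | h
  · exact dvd_mul_of_dvd_left (hq.1.dvd_of_dvd_pow h) _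
  · exact dvd_mul_of_dvd_right h _

/-- `N (W_{p,m}) ≤ 2¹⁰ p (p^{2m} + 1)`. [folklore] -/
theorem conductorNorm_testModel_le (hp : p.Prime) (hp2 : p ≠ 2) (m : ℕ) :
    ((testModel p m).baseChange ℚ).conductorNorm ℤ ≤ 2 ^ 10 * (p * (p ^ (2 * m) + 1)) := by
  have h1 := Nat.le_of_dvd (mul_pos (by positivity) (Nat.radical_pos _)) (conductorNorm_testModel_dvd hp hp2 m)
  exact h1.trans (Nat.mul_le_mul_left _ (radical_testProd_le hp m))

/-- `N (W_{p,m})` is squarefree away from `2`. [folklore] -/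
theorem not_sq_dvd_conductorNorm_testModel (hp : p.Prime) (hp2 : p ≠ 2) (m : ℕ) {q : ℕ} (hq : q.Prime)
    (hq2 : q ≠ 2) : ¬ q ^ 2 ∣ ((testModel p m).baseChange ℚ).conductorNorm ℤ := by
  intro hdvd
  have hcop : Nat.Coprime (q ^ 2) (2 ^ 10) :=
    Nat.Coprime.pow 2 10 ((Nat.coprime_primes hq Nat.prime_two).mpr hq2)
  have h1 : q ^ 2 ∣ radical (p ^ (2 * m) * (p ^ (2 * m) + 1)) :=
    hcop.dvd_of_dvd_mul_left (hdvd.trans (conductorNorm_testModel_dvd hp hp2 m))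
  have hsq := squarefree_radical (a := p ^ (2 * m) * (p ^ (2 * m) + 1))
  rw [Nat.squarefree_iff_prime_squarefree] at hsq
  exact hsq q hq (by rwa [sq] at h1)

/-- `p ∣ N (W_{p,m})` for `m ≥ 1` (`p` is a bad prime). [folklore] -/
theorem dvd_conductorNorm_testModel (hp : p.Prime) (hp2 : p ≠ 2) (hm : 1 ≤ m) :
    p ∣ ((testModel p m).baseChange ℚ).conductorNorm ℤ := by
  haveI := isElliptic_testModel hp m
  refine dvd_conductorNorm_of_dvd_Δ (testModel p m) (Δ_ne_zero_of_isElliptic_baseChange_int _)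
    (isMinimalAt_testModel hp hp2 m) hp ?_
  rw [testModel_Δ]
  have : p ∣ 16 * (p ^ (2 * m) * (p ^ (2 * m) + 1)) ^ 2 :=
    dvd_mul_of_dvd_right (dvd_pow (dvd_mul_of_dvd_left (dvd_pow_self p (by omega)) _) two_ne_zero) 16
  exact_mod_cast this

/-- `|Δ_min (W_{p,m})| = 16 (p^{2m}(p^{2m}+1))²`. [folklore] -/
theorem minimalDiscriminantNorm_testModel (hp : p.Prime) (hp2 : p ≠ 2) (m : ℕ) :
    ((testModel p m).baseChange ℚ).minimalDiscriminantNorm ℤ = 16 * (p ^ (2 * m) * (p ^ (2 * m) + 1)) ^ 2 := by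
  haveI := isElliptic_testModel hp m
  rw [minimalDiscriminantNorm_eq_natAbs_holds (testModel p m) (Δ_ne_zero_of_isElliptic_baseChange_int _)
    (isMinimalAt_testModel hp hp2 m), testModel_Δ, Int.natAbs_natCast]

/-- Real-number bookkeeping for `W_{p,m}` (`p` an odd prime, `m ≥ 1`, `X = p^{2m}`):
`p ≤ N ≤ 2¹¹ p X`, `|Δ_min| ≤ 64 X⁴`, `max(|Δ|, |c₄|³) ≥ X⁶ = p^{12m}`. [folklore] -/
theorem testModel_real_bounds (hp : p.Prime) (hp2 : p ≠ 2) (hm : 1 ≤ m) :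
    ((p : ℝ) ≤ ((((testModel p m).baseChange ℚ).conductorNorm ℤ : ℕ) : ℝ)) ∧
    (((((testModel p m).baseChange ℚ).conductorNorm ℤ : ℕ) : ℝ) ≤ 2 ^ 11 * (p : ℝ) * (p : ℝ) ^ (2 * m)) ∧
    (((((testModel p m).baseChange ℚ).minimalDiscriminantNorm ℤ : ℕ) : ℝ) ≤ 64 * ((p : ℝ) ^ (2 * m)) ^ 4) ∧
    ((p : ℝ) ^ (12 * m) ≤ ((max |(testModel p m).Δ| (|(testModel p m).c₄| ^ 3) : ℤ) : ℝ)) := by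
  haveI := isElliptic_testModel hp m
  have hP1 : (1 : ℝ) ≤ (p : ℝ) := by exact_mod_cast hp.one_lt.le
  have hP0 : (0 : ℝ) < (p : ℝ) := by linarith
  set X : ℝ := (p : ℝ) ^ (2 * m) with hX
  have hX1 : 1 ≤ X := one_le_pow₀ hP1
  have hX0 : 0 < X := by positivity
  refine ⟨?_, ?_, ?_, ?_⟩
  · exact_mod_cast Nat.le_of_dvd (conductorNorm_pos_holds _) (dvd_conductorNorm_testModel hp hp2 hm)
  · have h1 : ((((testModel p m).baseChange ℚ).conductorNorm ℤ : ℕ) : ℝ) ≤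
        ((2 ^ 10 * (p * (p ^ (2 * m) + 1)) : ℕ) : ℝ) := by
      exact_mod_cast conductorNorm_testModel_le hp hp2 m
    have h2 : (((2 ^ 10 * (p * (p ^ (2 * m) + 1)) : ℕ)) : ℝ) = 2 ^ 10 * (p : ℝ) * (X + 1) := by
      rw [hX]; push_cast; ring
    rw [h2] at h1
    nlinarith
  · have h1 : ((((testModel p m).baseChange ℚ).minimalDiscriminantNorm ℤ : ℕ) : ℝ) = 16 * (X * (X + 1)) ^ 2 := by
      rw [minimalDiscriminantNorm_testModel hp hp2 m, hX]; push_cast; ring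
    rw [h1]
    have h2 : X + 1 ≤ 2 * X := by linarith
    have h3 : (X * (X + 1)) ^ 2 ≤ (X * (2 * X)) ^ 2 :=
      pow_le_pow_left₀ (by positivity) (mul_le_mul_of_nonneg_left h2 hX0.le) 2
    nlinarith
  · have hc : ((testModel p m).c₄ : ℝ) = 16 * (1 + X + X ^ 2) := by
      rw [testModel_c₄, hX]; push_cast; ring
    have hc2 : X ^ 2 ≤ ((testModel p m).c₄ : ℝ) := by rw [hc]; nlinarith
    have hc0 : (0 : ℝ) ≤ ((testModel p m).c₄ : ℝ) := le_trans (by positivity) hc2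
    push_cast
    refine le_max_of_le_right ?_
    rw [abs_of_nonneg hc0]
    calc (p : ℝ) ^ (12 * m) = (X ^ 2) ^ 3 := by rw [hX, ← pow_mul, ← pow_mul]; ring_nf
      _ ≤ ((testModel p m).c₄ : ℝ) ^ 3 := pow_le_pow_left₀ (by positivity) hc2 3

set_option maxHeartbeats 400000 in
/-- **The exponent `6` is sharp inside every thin class**: for every `κ < 6`,
`ThinWeightedSzpiroExp κ` is false. Witnesses `W_{p,m}` (`m = m(κ)`, odd primes `p → ∞`),
certified θ-thin for every `θ > 0` by `p ∣ N` and the divisor bound. [folklore] -/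
theorem thinWeightedSzpiroExp_false_of_lt_six {κ : ℝ} (hκ : κ < 6) : ¬ ThinWeightedSzpiroExp κ := by
  rintro ⟨θ, hθ, hK⟩
  -- exponents
  set k : ℝ := max κ 0 with hk
  have hk0 : 0 ≤ k := le_max_right _ _
  have hk6 : k < 6 := max_lt hκ (by norm_num)
  set θ₁ : ℝ := min θ 1 with hθ₁
  have hθ₁0 : 0 < θ₁ := lt_min hθ one_pos
  have hθ₁1 : θ₁ ≤ 1 := min_le_right _ _
  have hθ₁θ : θ₁ ≤ θ := min_le_left _ _
  -- the parameter `m ≥ 1` with `m (6 − k) > k`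
  set m : ℕ := ⌈k / (6 - k)⌉₊ + 1 with hm
  have hm1 : 1 ≤ m := by omega
  have hmR : k / (6 - k) < m := by
    have := Nat.le_ceil (k / (6 - k))
    push_cast [hm]
    linarith
  have hmk : k < m * (6 - k) := by rwa [div_lt_iff₀ (by linarith)] at hmR
  have hmpos : (0 : ℝ) < m := by exact_mod_cast hm1
  have hm0 : (m : ℝ) ≠ 0 := hmpos.ne'
  -- divisor bound at `η = θ₁ / (8 m)`
  set η : ℝ := θ₁ / (8 * m) with hη
  have hη0 : 0 < η := by positivity
  have h8 : ((2 * m * 4 : ℕ) : ℝ) * η = θ₁ := by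
    rw [hη]; push_cast; field_simp; ring
  obtain ⟨Cη, hCη1, hτ⟩ := exists_card_divisors_le_mul_rpow hη0
  have hCη0 : 0 < Cη := by linarith
  -- the thinness constant and the adversary's constant
  set K : ℝ := Cη * (64 : ℝ) ^ η with hKdef
  have hK0 : 0 < K := by positivity
  obtain ⟨C, hC⟩ := hK K
  -- the exponent gap
  set e : ℝ := (2 * m + 1 + θ₁) * k with he
  have he0 : 0 ≤ e := by positivity
  set g : ℝ := 12 * m - e with hg
  have hg0 : 0 < g := by
    rw [hg, he]
    nlinarith
  -- the constant to beat and the prime `p`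
  set M : ℝ := max C 0 * ((2 : ℝ) ^ 11 * K) ^ k with hM
  have hM0 : 0 ≤ M := by positivity
  obtain ⟨p, hpge, hp⟩ := Nat.exists_infinite_primes (max 3 (⌈M ^ (1 / g)⌉₊ + 1))
  have hp3 : 3 ≤ p := le_of_max_le_left hpge
  have hp2 : p ≠ 2 := by omega
  -- the curve `W_{p,m}` and its real bounds
  obtain ⟨hNp, hNle, hDle, hL⟩ := testModel_real_bounds hp hp2 hm1
  haveI hE := isElliptic_testModel hp m
  have hmin := isMinimalAt_testModel hp hp2 m
  have hss : ∀ q : ℕ, q.Prime → q ≠ 2 → ¬ q ^ 2 ∣ ((testModel p m).baseChange ℚ).conductorNorm ℤ :=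
    fun q hq hq2 ↦ not_sq_dvd_conductorNorm_testModel hp hp2 m hq hq2
  have hT1 : (1 : ℝ) ≤ ((∏ q ∈ (((testModel p m).baseChange ℚ).conductorNorm ℤ).primeFactors with
      ¬ q ^ 2 ∣ ((testModel p m).baseChange ℚ).conductorNorm ℤ,
      (((testModel p m).baseChange ℚ).minimalDiscriminantNorm ℤ).factorization q : ℕ) : ℝ) := by
    exact_mod_cast WeightedSzpiroBound.one_le_tamWeight ((testModel p m).baseChange ℚ)
  have hTD : ((∏ q ∈ (((testModel p m).baseChange ℚ).conductorNorm ℤ).primeFactors with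
      ¬ q ^ 2 ∣ ((testModel p m).baseChange ℚ).conductorNorm ℤ,
      (((testModel p m).baseChange ℚ).minimalDiscriminantNorm ℤ).factorization q : ℕ) : ℝ) ≤
      ((((testModel p m).baseChange ℚ).minimalDiscriminantNorm ℤ).divisors.card : ℝ) := by
    exact_mod_cast weight_le_card_divisors ((testModel p m).baseChange ℚ)
  have hD0 : ((testModel p m).baseChange ℚ).minimalDiscriminantNorm ℤ ≠ 0 :=
    (minimalDiscriminantNorm_pos_holds _).ne'
  have hτD := hτ _ hD0
  -- abbreviations
  set P : ℝ := (p : ℝ) with hP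
  set N : ℕ := ((testModel p m).baseChange ℚ).conductorNorm ℤ with hNdef
  set D : ℕ := ((testModel p m).baseChange ℚ).minimalDiscriminantNorm ℤ with hDdef
  set T : ℕ := ∏ q ∈ N.primeFactors with ¬ q ^ 2 ∣ N, D.factorization q with hTdef
  set X : ℝ := P ^ (2 * m) with hX
  have hP1 : (1 : ℝ) < P := by rw [hP]; exact_mod_cast (by omega : 1 < p)
  have hP0 : (0 : ℝ) < P := by linarith
  have hX0 : (0 : ℝ) < X := by positivity
  have hN1 : (1 : ℝ) ≤ N := hP1.le.trans hNp
  have hPM : M < P ^ g := by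
    have h1 : M ^ (1 / g) < P := by
      have := Nat.le_ceil (M ^ (1 / g))
      have h2 : ((⌈M ^ (1 / g)⌉₊ + 1 : ℕ) : ℝ) ≤ P := by rw [hP]; exact_mod_cast le_of_max_le_right hpge
      push_cast at h2
      linarith
    have h2 : (M ^ (1 / g)) ^ g < P ^ g := Real.rpow_lt_rpow (Real.rpow_nonneg hM0 _) h1 hg0
    rwa [← Real.rpow_mul hM0, one_div_mul_cancel hg0.ne', Real.rpow_one] at h2
  -- `T ≤ Cη D^η ≤ K P^{θ₁}`
  have hTle : (T : ℝ) ≤ K * P ^ θ₁ := by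
    have h3 : (D : ℝ) ^ η ≤ (64 * X ^ (4 : ℕ)) ^ η := Real.rpow_le_rpow (by positivity) hDle hη0.le
    have h6 : (64 * X ^ (4 : ℕ)) ^ η = (64 : ℝ) ^ η * P ^ θ₁ := by
      rw [Real.mul_rpow (by norm_num) (by positivity), hX, ← pow_mul, ← Real.rpow_natCast P (2 * m * 4),
        ← Real.rpow_mul hP0.le, h8]
    calc (T : ℝ) ≤ Cη * (D : ℝ) ^ η := hTD.trans hτD
      _ ≤ Cη * (64 * X ^ (4 : ℕ)) ^ η := mul_le_mul_of_nonneg_left h3 hCη0.le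
      _ = K * P ^ θ₁ := by rw [h6, hKdef]; ring
  -- the class condition at level `θ`
  have hthin : (T : ℝ) ≤ K * (N : ℝ) ^ θ := by
    calc (T : ℝ) ≤ K * P ^ θ₁ := hTle
      _ ≤ K * (N : ℝ) ^ θ₁ := mul_le_mul_of_nonneg_left (Real.rpow_le_rpow hP0.le hNp hθ₁0.le) hK0.le
      _ ≤ K * (N : ℝ) ^ θ := mul_le_mul_of_nonneg_left (Real.rpow_le_rpow_of_exponent_le hN1 hθ₁θ) hK0.le
  have key := hC (testModel p m) hE hmin hss (by simpa only [hNdef, hTdef, hDdef] using hthin)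
  have key' : ((max |(testModel p m).Δ| (|(testModel p m).c₄| ^ 3) : ℤ) : ℝ) ≤ C * ((N : ℝ) * T) ^ κ := by
    simpa only [hNdef, hTdef, hDdef] using key
  -- `N T ≤ 2¹¹ K · P^{2m+1+θ₁}`
  have hNT1 : (1 : ℝ) ≤ (N : ℝ) * T := one_le_mul_of_one_le_of_one_le hN1 hT1
  have hPe : P ^ (2 * m) * P * P ^ θ₁ = P ^ (2 * m + 1 + θ₁) := by
    rw [Real.rpow_add hP0, Real.rpow_add hP0, Real.rpow_one, ← Real.rpow_natCast P (2 * m)]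
    push_cast; ring
  have hNT : (N : ℝ) * T ≤ 2 ^ 11 * K * P ^ (2 * m + 1 + θ₁) := by
    calc (N : ℝ) * T ≤ (2 ^ 11 * P * X) * (K * P ^ θ₁) :=
          mul_le_mul hNle hTle (by positivity) (by positivity)
      _ = 2 ^ 11 * K * (P ^ (2 * m) * P * P ^ θ₁) := by rw [hX]; ring
      _ = 2 ^ 11 * K * P ^ (2 * m + 1 + θ₁) := by rw [hPe]
  -- `(N T)^κ ≤ (2¹¹ K)^k P^e`
  have h2K : (0 : ℝ) ≤ 2 ^ 11 * K := by positivity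
  have hpow : ((N : ℝ) * T) ^ κ ≤ (2 ^ 11 * K) ^ k * P ^ e := by
    calc ((N : ℝ) * T) ^ κ ≤ ((N : ℝ) * T) ^ k :=
          Real.rpow_le_rpow_of_exponent_le hNT1 (le_max_left _ _)
      _ ≤ (2 ^ 11 * K * P ^ (2 * m + 1 + θ₁)) ^ k := Real.rpow_le_rpow (by positivity) hNT hk0
      _ = (2 ^ 11 * K) ^ k * (P ^ (2 * m + 1 + θ₁)) ^ k :=
          Real.mul_rpow h2K (Real.rpow_nonneg hP0.le _)
      _ = (2 ^ 11 * K) ^ k * P ^ e := by rw [← Real.rpow_mul hP0.le, he]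
  have hR : C * ((N : ℝ) * T) ^ κ ≤ M * P ^ e := by
    calc C * ((N : ℝ) * T) ^ κ ≤ max C 0 * ((N : ℝ) * T) ^ κ :=
          mul_le_mul_of_nonneg_right (le_max_left _ _) (Real.rpow_nonneg (by positivity) _)
      _ ≤ max C 0 * ((2 ^ 11 * K) ^ k * P ^ e) := mul_le_mul_of_nonneg_left hpow (le_max_right _ _)
      _ = M * P ^ e := by rw [hM]; ring
  -- `P^{12m} = P^g · P^e`, combine
  have hsplit : P ^ (12 * m) = P ^ g * P ^ e := by
    rw [← Real.rpow_natCast P (12 * m), ← Real.rpow_add hP0, hg]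
    push_cast; ring_nf
  have hPe0 : 0 < P ^ e := Real.rpow_pos_of_pos hP0 e
  have h1 : P ^ g * P ^ e ≤ M * P ^ e := by
    rw [← hsplit]
    exact hL.trans (key'.trans hR)
  have h3 : P ^ g ≤ M := le_of_mul_le_mul_right h1 hPe0
  linarith

/-- Corollary: no exponent below `6` works in the crux — thin class, weight and all. [folklore] -/
theorem not_exists_thinWeightedSzpiroExp_lt_six : ¬ ∃ κ : ℝ, κ < 6 ∧ ThinWeightedSzpiroExp κ :=
  fun ⟨_, hκ, h⟩ ↦ thinWeightedSzpiroExp_false_of_lt_six hκ h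

end Tight


end Summit.ABC.ABC.Theorems.ThinWeightedSzpiro.Negative
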